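import Literature.NumberTheory.Automorphic.FundamentalDomainCosetUnfolding
import Literature.NumberTheory.Automorphic.ShimuraCurve
import Literature.NumberTheory.EllipticCurves.ModularCurveGamma0IndexProofs
import HarnessLib

/-!
# The covolume of a Fuchsian group does not depend on the fundamental domain; the covolume of
# `Γ₀(N)` and of conjugate groups; the group `Γ₀^D(M) = ι(O¹)` of a Shimura curve datum

Topic `NumberTheory/Automorphic`; theorems only (no definition, no named fact, no instance). First
brick (the measure-theoretic plumbing, "Step 0") of the proof of the named fact
`Literature.NumberTheory.Automorphic.ShimuraCurveData.volume_fd_eq` (Shimizu 1963; Vignéras,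
LNM 800, Ch. IV §3.A: the hyperbolic area of `X₀^D(M)` is `(π/3) φ(D) ψ(M)`), which is stated for
the ARBITRARY measurable a.e. fundamental domain `X.fd` carried by a Shimura curve datum. Vignéras
IV §1 (after Déf. of a fundamental domain): the volume of a fundamental domain of a discrete
`Γ ≤ SL₂(ℝ)` of finite covolume does not depend on its choice; Iwaniec, *Spectral Methods* §2.2.
Here, on top of the unfolding identity `Σ_{γ ∈ Γ} ∫_F φ(γ w) dμ(w) = 2 ∫_ℍ φ dμ` of
`FundamentalDomainUnfolding` (tree) for the `Literature` notion `IsHypFundamentalDomain Γ F`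
(`HyperbolicLaplaceSpectrum.lean`; `Γ ≤ GL₂(ℝ)` inside the image of `SL₂(ℝ)`, `-1 ∈ Γ`, countable):

1. `IsHypFundamentalDomain.volume_eq` — **two fundamental domains of `Γ` have the same hyperbolic
   area** (unfold `𝟙_{F'}` over `F` and `𝟙_F` over `F'`; the two double sums agree term by term
   after `γ ↦ γ⁻¹`, by the `GL₂(ℝ)`-invariance of `dx dy / y²`).
2. `IsHypFundamentalDomain.volume_eq_of_conjAct` — fundamental domains of `Γ` and of a conjugate
   `g⁻¹ Γ g` (`g ∈ GL₂(ℝ)`) have the same area (transport `IsHypFundamentalDomain.conjAct_inv_smul`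
   of `FundamentalDomainCosetUnfolding`, tree).
3. `volume_eq_index_mul_of_isHypFundamentalDomain_map` — for `Γ' ≤ SL₂(ℤ)` of finite index with
   `-1 ∈ Γ'`, EVERY fundamental domain of its image in `GL₂(ℝ)` has area `[SL₂(ℤ) : Γ'] · π/3`
   (coset unfolding `setLIntegral_eq_setLIntegral_fd_sum_cosets`, tree, with `ψ = 1`, and
   `volume 𝒟 = π/3`, tree); in particular (`volume_eq_of_isHypFundamentalDomain_gamma0`)
   **`vol(Γ₀(N)∖ℍ) = (π/3) ψ(N)`**, `ψ(N) = N ∏_{p ∣ N}(1 + 1/p) = gamma0Index N` (tree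
   `index_gamma0_eq_gamma0Index_holds`) — the case `D = 1` of Shimizu's formula for the standard
   Eichler order of level `N` in `M₂(ℚ)`.
4. The group `X.Gamma = ι(O¹)` of a Shimura curve datum (`ShimuraCurve.lean`) is countable and lies
   in the image of `SL₂(ℝ)` (`ShimuraCurveData.countable_Gamma`, `le_range_toGL_of_hasDetOne`), so
   1 applies: `ShimuraCurveData.volume_eq_volume_fd` — the area of ANY fundamental domain of
   `Γ₀^D(M)` is `volume X.fd`. This reduces `volume_fd_eq` to computing the area of one convenient
   fundamental domain of one conjugate of `ι(O¹)`.

## References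

* M.-F. Vignéras, *Arithmétique des algèbres de quaternions*, LNM 800 (1980), Ch. IV §1 (groupes
  de quaternions, domaine fondamental) and §3.A [VignerasLNM800].
* H. Iwaniec, *Spectral Methods of Automorphic Forms*, GSM 53 (2002), §2.2 and Prop. 2.4
  [Iwaniec2002].
* G. Shimura, *Introduction to the arithmetic theory of automorphic functions* (1971), Prop. 1.43
  (`[SL₂(ℤ) : Γ₀(N)]`) [ShimuraIATAF1971].

## Mathlib / tree search

Tree: `tsum_setLIntegral_smul_eq`, `setLIntegral_smul_eq` (`FundamentalDomainUnfolding`),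
`IsHypFundamentalDomain.conjAct_inv_smul`, `setLIntegral_eq_setLIntegral_fd_sum_cosets`
(`FundamentalDomainCosetUnfolding`), `volume_modular_fd` (`HyperbolicLaplaceSpectrum`),
`index_gamma0_eq_gamma0Index_holds` (`EllipticCurves/ModularCurveGamma0IndexProofs`). Mathlib:
`SMulInvariantMeasure (GL (Fin 2) ℝ) ℍ volume`, `MeasureTheory.measure_smul`,
`Matrix.SpecialLinearGroup.toGL`, `Subgroup.fintypeQuotientOfFiniteIndex`,
`CongruenceSubgroup.instFiniteIndexGamma0`. No statement of 1–4 exists in Mathlib or the tree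
(`lean search 'volume F = volume|IsHypFundamentalDomain\.'`).
-/

noncomputable section

namespace Literature.NumberTheory.Automorphic

open _root_.MeasureTheory Set Filter UpperHalfPlane
open scoped MatrixGroups ENNReal Pointwise

/-! ## 1. Two fundamental domains have the same area -/

section Independence

variable {Γ : Subgroup (GL (Fin 2) ℝ)} {F F' : Set ℍ}

/-- `∫_F 𝟙_{F'}(γ w) dμ(w) = ∫_{F'} 𝟙_F(γ⁻¹ w) dμ(w)` (both are `vol(γF ∩ F')`, by the invariance of
`dμ`). [folklore] -/
theorem setLIntegral_indicator_smul_comm (hF : IsHypFundamentalDomain Γ F) (hF' : MeasurableSet F')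
    (γ : GL (Fin 2) ℝ) :
    ∫⁻ w in F, F'.indicator (fun _ => (1 : ℝ≥0∞)) (γ • w) =
      ∫⁻ w in F', F.indicator (fun _ => (1 : ℝ≥0∞)) (γ⁻¹ • w) := by
  rw [setLIntegral_smul_eq hF γ, ← lintegral_indicator hF']
  refine lintegral_congr fun w => ?_
  by_cases hw : w ∈ F'
  · rw [indicator_of_mem hw, indicator_of_mem hw, mul_one]
  · rw [indicator_of_notMem hw, indicator_of_notMem hw, mul_zero]

/-- **The covolume does not depend on the fundamental domain.** For `Γ ≤ GL₂(ℝ)` contained in the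
image of `SL₂(ℝ)`, containing `-1` and countable, any two measurable a.e. fundamental domains
(`IsHypFundamentalDomain`) have the same hyperbolic area (Vignéras IV §1; Iwaniec §2.2). Proof:
unfolding `𝟙_{F'}` over `F` gives `Σ_γ vol(F ∩ γ⁻¹F') = 2 vol(F')`, unfolding `𝟙_F` over `F'`
gives `Σ_γ vol(F' ∩ γ⁻¹F) = 2 vol(F)`, and the sums agree after `γ ↦ γ⁻¹`.
[cite: VignerasLNM800, Ch. IV §1 (domaine fondamental)] -/
theorem IsHypFundamentalDomain.volume_eq
    (hΓ : Γ ≤ (Matrix.SpecialLinearGroup.toGL : SL(2, ℝ) →* GL (Fin 2) ℝ).range)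
    (hneg : (-1 : GL (Fin 2) ℝ) ∈ Γ) (hc : (Γ : Set (GL (Fin 2) ℝ)).Countable)
    (hF : IsHypFundamentalDomain Γ F) (hF' : IsHypFundamentalDomain Γ F') :
    volume F = volume F' := by
  have hmF : AEMeasurable (F.indicator fun _ => (1 : ℝ≥0∞)) volume :=
    (measurable_const.indicator hF.measurableSet).aemeasurable
  have hmF' : AEMeasurable (F'.indicator fun _ => (1 : ℝ≥0∞)) volume :=
    (measurable_const.indicator hF'.measurableSet).aemeasurable
  -- unfolding `𝟙_{F'}` over `F` and `𝟙_F` over `F'`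
  have h1 := tsum_setLIntegral_smul_eq hΓ hneg hc hF hmF'
  have h2 := tsum_setLIntegral_smul_eq hΓ hneg hc hF' hmF
  rw [lintegral_indicator hF'.measurableSet, setLIntegral_one] at h1
  rw [lintegral_indicator hF.measurableSet, setLIntegral_one] at h2
  -- the two sums agree
  have h3 : ∑' γ : Γ, ∫⁻ w in F, F'.indicator (fun _ => (1 : ℝ≥0∞)) ((γ : GL (Fin 2) ℝ) • w) =
      ∑' γ : Γ, ∫⁻ w in F', F.indicator (fun _ => (1 : ℝ≥0∞)) ((γ : GL (Fin 2) ℝ) • w) := by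
    rw [← Equiv.tsum_eq (Equiv.inv Γ)]
    refine tsum_congr fun γ => ?_
    rw [Equiv.inv_apply, Subgroup.coe_inv, setLIntegral_indicator_smul_comm hF hF'.measurableSet,
      inv_inv]
  rw [h3, h2] at h1
  have h2ne : (2 : ℝ≥0∞) ≠ 0 := two_ne_zero
  have h2top : (2 : ℝ≥0∞) ≠ ⊤ := ENNReal.ofNat_ne_top
  exact (ENNReal.mul_right_inj h2ne h2top).mp h1

/-- A conjugate `g⁻¹ Γ g` of a subgroup of the image of `SL₂(ℝ)` lies in that image. [folklore] -/
theorem conjAct_inv_smul_le_range_toGL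
    (hΓ : Γ ≤ (Matrix.SpecialLinearGroup.toGL : SL(2, ℝ) →* GL (Fin 2) ℝ).range) (g : GL (Fin 2) ℝ) :
    (ConjAct.toConjAct g⁻¹ • Γ : Subgroup (GL (Fin 2) ℝ)) ≤
      (Matrix.SpecialLinearGroup.toGL : SL(2, ℝ) →* GL (Fin 2) ℝ).range := by
  intro x hx
  rw [mem_conjAct_inv_smul_iff] at hx
  obtain ⟨y, hy⟩ := hΓ hx
  have hdet : Matrix.det (x : Matrix (Fin 2) (Fin 2) ℝ) = 1 := by
    have h1 : Matrix.GeneralLinearGroup.det (g * x * g⁻¹) = 1 := by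
      rw [← hy]; ext; simp
    have h2 : Matrix.GeneralLinearGroup.det x = 1 := by
      rw [map_mul, map_mul, map_inv, mul_inv_cancel_comm] at h1
      exact h1
    have := congrArg Units.val h2
    simpa using this
  exact ⟨⟨(x : Matrix (Fin 2) (Fin 2) ℝ), hdet⟩, Units.ext rfl⟩

/-- `-1 ∈ g⁻¹ Γ g` when `-1 ∈ Γ`. [folklore] -/
theorem neg_one_mem_conjAct_inv_smul (hneg : (-1 : GL (Fin 2) ℝ) ∈ Γ) (g : GL (Fin 2) ℝ) :
    (-1 : GL (Fin 2) ℝ) ∈ (ConjAct.toConjAct g⁻¹ • Γ : Subgroup (GL (Fin 2) ℝ)) := by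
  rw [mem_conjAct_inv_smul_iff]
  simpa using hneg

/-- `g⁻¹ Γ g` is countable when `Γ` is. [folklore] -/
theorem countable_conjAct_inv_smul (hc : (Γ : Set (GL (Fin 2) ℝ)).Countable) (g : GL (Fin 2) ℝ) :
    ((ConjAct.toConjAct g⁻¹ • Γ : Subgroup (GL (Fin 2) ℝ)) : Set (GL (Fin 2) ℝ)).Countable := by
  rw [Subgroup.coe_pointwise_smul]
  exact hc.image _

/-- **Conjugate groups have the same covolume**: if `F` is a fundamental domain of `Γ` and `F₁` one
of `g⁻¹ Γ g` (`g ∈ GL₂(ℝ)`), then `vol(F₁) = vol(F)` — `g⁻¹ F` is a fundamental domain of `g⁻¹ Γ g`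
of area `vol(F)` (invariance of `dμ`), and 1. [cite: VignerasLNM800, Ch. IV §1 (domaine fondamental)] -/
theorem IsHypFundamentalDomain.volume_eq_of_conjAct
    (hΓ : Γ ≤ (Matrix.SpecialLinearGroup.toGL : SL(2, ℝ) →* GL (Fin 2) ℝ).range)
    (hneg : (-1 : GL (Fin 2) ℝ) ∈ Γ) (hc : (Γ : Set (GL (Fin 2) ℝ)).Countable)
    (hF : IsHypFundamentalDomain Γ F) (g : GL (Fin 2) ℝ) {F₁ : Set ℍ}
    (hF₁ : IsHypFundamentalDomain (ConjAct.toConjAct g⁻¹ • Γ) F₁) :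
    volume F₁ = volume F := by
  rw [IsHypFundamentalDomain.volume_eq (conjAct_inv_smul_le_range_toGL hΓ g)
    (neg_one_mem_conjAct_inv_smul hneg g) (countable_conjAct_inv_smul hc g) hF₁ (hF.conjAct_inv_smul g)]
  exact measure_smul (μ := (volume : Measure ℍ)) g⁻¹ F

end Independence

/-! ## 2. The covolume of a finite-index subgroup of `SL₂(ℤ)`; `Γ₀(N)` -/

section Modular

variable {Γ' : Subgroup SL(2, ℤ)} {F₁ : Set ℍ}

/-- **Covolume of a finite-index subgroup of the modular group.** For `Γ' ≤ SL₂(ℤ)` of finite index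
containing `-1`, EVERY fundamental domain `F₁` of its image in `GL₂(ℝ)` has hyperbolic area
`[SL₂(ℤ) : Γ'] · vol(𝒟) = [SL₂(ℤ) : Γ'] · π/3` (Iwaniec Prop. 2.4: a fundamental domain of `Γ'` is
a union of `[Γ : Γ']` translates of one of `Γ`; here through the coset unfolding of
`FundamentalDomainCosetUnfolding` with `ψ = 1`). [cite: Iwaniec2002, §2.4 Prop. 2.4] -/
theorem volume_eq_index_mul_of_isHypFundamentalDomain_map [Γ'.FiniteIndex]
    (hneg : (-1 : SL(2, ℤ)) ∈ Γ')
    (hF₁ : IsHypFundamentalDomain (Γ'.map (Matrix.SpecialLinearGroup.mapGL ℝ)) F₁) :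
    volume F₁ = (Γ'.index : ℝ≥0∞) * ENNReal.ofReal (Real.pi / 3) := by
  classical
  letI : Fintype (SL(2, ℤ) ⧸ Γ') := Subgroup.fintypeQuotientOfFiniteIndex
  have h := setLIntegral_eq_setLIntegral_fd_sum_cosets hneg hF₁ (ψ := fun _ => (1 : ℝ≥0∞))
    measurable_const (fun _ _ _ => rfl)
  rw [setLIntegral_one] at h
  rw [h]
  simp only [Finset.sum_const, Finset.card_univ, nsmul_eq_mul, mul_one]
  rw [setLIntegral_const, volume_modular_fd, Subgroup.index_eq_card, Nat.card_eq_fintype_card]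

/-- `-1 ∈ Γ₀(N)`. [folklore] -/
theorem neg_one_mem_Gamma0 (N : ℕ) : (-1 : SL(2, ℤ)) ∈ CongruenceSubgroup.Gamma0 N := by
  rw [CongruenceSubgroup.Gamma0_mem]
  simp

/-- **`vol(Γ₀(N)∖ℍ) = (π/3) ψ(N)`**, `ψ(N) = N ∏_{p ∣ N}(1 + 1/p)` (`gamma0Index N`), for every
fundamental domain of (the image in `GL₂(ℝ)` of) `Γ₀(N)`, `N ≥ 1`: the case `D = 1`, standard
Eichler order `(ℤ ℤ; Nℤ ℤ)` of Shimizu's / Vignéras' volume formula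
`vol(Γ₀^D(N)∖ℍ) = (π/3) ∏_{p∣D}(p-1) · N ∏_{p∣N}(1+1/p)`. [cite: VignerasLNM800, Ch. IV §3.A (volume des groupes de congruence)] -/
theorem volume_eq_of_isHypFundamentalDomain_gamma0 (N : ℕ) [NeZero N]
    (hF₁ : IsHypFundamentalDomain
      ((CongruenceSubgroup.Gamma0 N).map (Matrix.SpecialLinearGroup.mapGL ℝ)) F₁) :
    volume F₁ = ENNReal.ofReal (Real.pi / 3 *
      (Literature.NumberTheory.EllipticCurves.ModularForms.gamma0Index N : ℝ)) := by
  rw [volume_eq_index_mul_of_isHypFundamentalDomain_map (neg_one_mem_Gamma0 N) hF₁]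
  have hidx : (CongruenceSubgroup.Gamma0 N).index =
      Literature.NumberTheory.EllipticCurves.ModularForms.gamma0Index N :=
    Literature.NumberTheory.EllipticCurves.ModularForms.index_gamma0_eq_gamma0Index_holds N
  rw [hidx, ENNReal.ofReal_mul (by positivity), ENNReal.ofReal_natCast, mul_comm]

end Modular

/-! ## 3. The group `Γ₀^D(M) = ι(O¹)` of a Shimura curve datum -/

section Shimura

/-- A subgroup of `GL₂(ℝ)` of determinant one lies in the image of `SL₂(ℝ)`. [folklore] -/
theorem le_range_toGL_of_hasDetOne (Γ : Subgroup (GL (Fin 2) ℝ)) [Γ.HasDetOne] :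
    Γ ≤ (Matrix.SpecialLinearGroup.toGL : SL(2, ℝ) →* GL (Fin 2) ℝ).range := by
  intro g hg
  have hdet : Matrix.GeneralLinearGroup.det g = 1 := Subgroup.HasDetOne.det_eq hg
  have hdet' : Matrix.det (g : Matrix (Fin 2) (Fin 2) ℝ) = 1 := by
    have := congrArg Units.val hdet
    simpa using this
  exact ⟨⟨(g : Matrix (Fin 2) (Fin 2) ℝ), hdet'⟩, Units.ext rfl⟩

variable {D M : ℕ}

/-- The quaternion algebra of a Shimura curve datum is countable (it is `≅ ℚ⁴`). [folklore] -/
theorem ShimuraCurveData.countable_B (X : ShimuraCurveData D M) : Countable X.B :=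
  Function.Injective.countable (Module.finBasis ℚ X.B).equivFun.injective

/-- **`Γ₀^D(M) = ι(O¹)` is countable** (it injects into `ι(B) ≅ ℚ⁴`). [folklore] -/
theorem ShimuraCurveData.countable_Gamma (X : ShimuraCurveData D M) :
    (X.Gamma : Set (GL (Fin 2) ℝ)).Countable := by
  haveI : Countable X.B := X.countable_B
  have hsub : (X.Gamma : Set (GL (Fin 2) ℝ)) ⊆
      (fun g : GL (Fin 2) ℝ => (g : Matrix (Fin 2) (Fin 2) ℝ)) ⁻¹' Set.range X.ι := by
    rintro g ⟨⟨x, -, hxg⟩, -, -⟩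
    exact ⟨x, hxg⟩
  refine Set.Countable.mono hsub ((Set.countable_range X.ι).preimage_of_injOn ?_)
  exact Set.injOn_of_injective Units.val_injective

/-- `Γ₀^D(M) ≤ SL₂(ℝ)` (as the image of `SL₂(ℝ)` in `GL₂(ℝ)`). [folklore] -/
theorem ShimuraCurveData.Gamma_le_range_toGL (X : ShimuraCurveData D M) :
    X.Gamma ≤ (Matrix.SpecialLinearGroup.toGL : SL(2, ℝ) →* GL (Fin 2) ℝ).range :=
  le_range_toGL_of_hasDetOne X.Gamma

/-- **The area of `X₀^D(M)(ℂ)` is well defined**: every fundamental domain of `Γ₀^D(M)` has the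
same hyperbolic area as the datum's `X.fd` (1, for the countable group `ι(O¹) ∋ -1` of determinant
one). This is the remark "any two a.e.-exact measurable fundamental domains of `Γ ∋ -1` have the
same measure" in the docstring of `ShimuraCurveData.volume_fd_eq`. [cite: VignerasLNM800, Ch. IV §1 (domaine fondamental)] -/
theorem ShimuraCurveData.volume_eq_volume_fd (X : ShimuraCurveData D M) {F : Set ℍ}
    (hF : IsHypFundamentalDomain X.Gamma F) : volume F = volume X.fd :=
  IsHypFundamentalDomain.volume_eq X.Gamma_le_range_toGL X.neg_one_mem_Gamma X.countable_Gamma hF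
    X.isHypFundamentalDomain_fd

/-- The same for a fundamental domain of a conjugate `g⁻¹ Γ₀^D(M) g`, `g ∈ GL₂(ℝ)` (2): changing the
real splitting `ι` by an inner automorphism of `M₂(ℝ)` does not change the area. [cite: VignerasLNM800, Ch. IV §1 (domaine fondamental)] -/
theorem ShimuraCurveData.volume_eq_volume_fd_of_conjAct (X : ShimuraCurveData D M) (g : GL (Fin 2) ℝ)
    {F₁ : Set ℍ} (hF₁ : IsHypFundamentalDomain (ConjAct.toConjAct g⁻¹ • X.Gamma) F₁) :
    volume F₁ = volume X.fd :=
  IsHypFundamentalDomain.volume_eq_of_conjAct X.Gamma_le_range_toGL X.neg_one_mem_Gamma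
    X.countable_Gamma X.isHypFundamentalDomain_fd g hF₁

end Shimura

end Literature.NumberTheory.Automorphic

end
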